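import Mathlib.Analysis.InnerProductSpace.PiL2
import Mathlib.Analysis.InnerProductSpace.Projection.FiniteDimensional
import Mathlib.LinearAlgebra.QuadraticForm.Signature
import Mathlib.LinearAlgebra.BilinearForm.Orthogonal
import Mathlib.LinearAlgebra.Matrix.BilinearForm
import HarnessLib

/-!
# Hessians of boundary-adapted functions: index and nondegeneracy of `κ D + N ⟪g, ·⟫ ⟪g, ·⟫`
(topic `Literature/Geometry/Riemannian`; linear algebra for the discharge of the named fact
`Literature.Geometry.Riemannian.Sha1986_homotopyEquiv_cwComplex_of_pConvex` of
`PConvexDomainHomotopyType.lean` — Sha 1986, Thm. 1, flat case: a compact domain `Ω = {F ≤ 0}`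
in `ℝⁿ⁺¹` with `p`-convex boundary has the homotopy type of a finite CW complex of dimension
`≤ p - 1`)

**Role.**  The printed proofs (Sha, Invent. Math. 83 (1986); Wu, Indiana Univ. Math. J. 36
(1987); Xiong, Int. J. Math. 29 (2018), §4) build a strictly `p`-convex proper function from
the distance to the boundary, smooth it (Greene–Wu) and apply Morse theory; the index bound at
a critical point is the Ky Fan lemma (`sigNeg_lt_of_forall_orthonormal_sum_pos` in
`PConvexDomainHomotopyType.lean`).  In the flat case the tree's interior Morse theory
(`Literature.Topology.FourManifolds.IsMorseAdapted`, `IsHandlebodyOfIndexLE`, regular sublevel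
sets) is reached without the smoothing theorem by the classical *boundary-adapted height
function* of Morse theory on manifolds with boundary (only the boundary critical points of a
generic height function `⟪a, ·⟫|∂Ω` at which `a` points into `Ω` attach handles, of index the
Morse index of `⟪a, ·⟫|∂Ω`; this is also the mechanism named by the route `ConvexityLadder`,
item `CvxThreeConvexBoundsTwoHandlebody`): for a suitable one-variable profile `λ` the function
`G = 1 + λ(-F) · (⟪a, ·⟫ - c₁)` has `{G ≤ 1} = Ω`, regular top level `G|∂Ω = 1`, and at each of
its critical points `x` (all in a thin collar of `∂Ω`, with `∇F(x)` antiparallel to `a`)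

  `D²G(x) = κ · D²F(x) + N · DF(x) ⊗ DF(x)`,  `κ > 0`, `N` as large as wanted.

This file proves the linear algebra of such forms on a finite-dimensional real inner product
space `U` (`D` symmetric bilinear, `g ≠ 0`, `T = g^⊥` the tangent hyperplane):

* `finrank_lt_of_forall_orthonormal_sum_pos_of_nonpos` — the Ky Fan index lemma in nonpositive
  form: if `∑ᵢ Q(vᵢ) > 0` on orthonormal `p`-frames then every subspace on which `Q ≤ 0` has
  dimension `< p`;
* `sigNeg_lt_of_tangential_sum_pos` — **index bound**: if `D|T` is `p`-positive with margin
  `η` (`∑ᵢ D(vᵢ, vᵢ) ≥ η` on orthonormal `p`-frames of `T`), `|D| ≤ M` and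
  `N ‖g‖² ≥ κ (M + 2 p M² / η)`, then `sigNeg (κ D + N ⟪g, ·⟫ ⟪g, ·⟫) < p` — so the critical
  points of `G` have Morse index `≤ p - 1` when `∂Ω` is `p`-convex (no nondegeneracy of
  `D|T` needed; proof through a maximal positive subspace of the shifted tangential form
  `(D - ε ⟪·, ·⟫)|T` and its `D`-orthogonal complement, Mathlib `sigPos`/`sigNeg`,
  `LinearMap.BilinForm.finrank_add_finrank_orthogonal`; no spectral theorem);
* `nondegenerate_of_tangential_margin` — **nondegeneracy**: if `D|T` is nondegenerate with
  margin `m₀` and `N ‖g‖² > κ M (1 + M / m₀)`, the form is nondegenerate (for a generic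
  direction `a` the tangential Hessians at the finitely many inward-horizontal boundary points
  are nondegenerate).

Everything is proved; no definitions, no named facts.  Mathlib search: `sigPos`, `sigNeg`,
`exists_finrank_eq_sigPos_and_posDef`, `le_sigPos_of_posDef` (`QuadraticForm/Signature.lean`),
`LinearMap.BilinForm.orthogonal`, `finrank_add_finrank_orthogonal`,
`Nondegenerate.ofSeparatingLeft`; nothing on `p`-positive forms (`lean search 'sigNeg'` in
`Literature`: `morseIndex` and the Ky Fan lemma of `PConvexDomainHomotopyType.lean` only).

## References

* J.-P. Sha, *`p`-convex Riemannian manifolds*, Invent. Math. 83 (1986), 437–447, Thm. 1.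
  [Sha1986]
* C. Xiong, *Homotopy type of manifolds with partially horoconvex boundary*, Int. J. Math. 29
  (2018), Thm. 4 (i) and §4. [Xiong2018]
* J. Milnor, *Morse theory*, Ann. of Math. Studies 51 (1963), §§2–3, §6. [Milnor1963]
-/

noncomputable section

open scoped InnerProductSpace
open Module

namespace Literature.Geometry.Riemannian

section IndexBound

variable {U : Type*} [NormedAddCommGroup U] [InnerProductSpace ℝ U] [FiniteDimensional ℝ U]

/-- **The Ky Fan index lemma, nonpositive form.**  If a quadratic form `Q` on a
finite-dimensional real inner product space has `∑ᵢ Q(vᵢ) > 0` for every orthonormal `p`-frame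
`(vᵢ)`, then every subspace on which `Q ≤ 0` (not necessarily negative definite) has dimension
`< p`: a subspace of dimension `≥ p` contains an orthonormal `p`-frame (Mathlib
`stdOrthonormalBasis`), on which the sum is `≤ 0`.  (Variant of
`sigNeg_lt_of_forall_orthonormal_sum_pos`, used below for the orthogonal complement of a
maximal positive subspace, on which a form is only known to be nonpositive.) [folklore] -/
theorem finrank_lt_of_forall_orthonormal_sum_pos_of_nonpos (Q : QuadraticForm ℝ U) {p : ℕ}
    (h : ∀ v : Fin p → U, Orthonormal ℝ v → 0 < ∑ i, Q (v i))
    (Z : Submodule ℝ U) (hZ : ∀ z ∈ Z, Q z ≤ 0) : finrank ℝ Z < p := by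
  by_contra hle
  have hp : p ≤ finrank ℝ Z := not_lt.mp hle
  let b := stdOrthonormalBasis ℝ Z
  let v : Fin p → U := fun i => (b (Fin.castLE hp i) : U)
  have hv : Orthonormal ℝ v :=
    ((b.orthonormal.comp _ (Fin.castLE_injective hp)).comp_linearIsometry Z.subtypeₗᵢ)
  have hsum := h v hv
  have hle' : ∑ i, Q (v i) ≤ 0 :=
    Finset.sum_nonpos fun i _ => hZ _ (b (Fin.castLE hp i)).2
  exact absurd hsum (not_lt.mpr hle')

/-- **Index bound for the Hessian of a boundary-adapted function.**  Let `D` be a symmetric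
bilinear form on a finite-dimensional real inner product space `U` with `|D(u, w)| ≤ M ‖u‖ ‖w‖`,
let `g ≠ 0` (the gradient direction) and suppose `D` is `p`-positive on the hyperplane
`T = g^⊥` with margin `η > 0`: `∑ᵢ D(vᵢ, vᵢ) ≥ η` for every orthonormal `p`-frame `(vᵢ)` in
`T` (`p ≥ 1`).  Then for `κ > 0` and `N ‖g‖² ≥ κ (M + 2 p M² / η)` the form
`B(u, w) = κ D(u, w) + N ⟪g, u⟫ ⟪g, w⟫` has negative index of inertia `sigNeg B < p`.  This is
the shape of the Hessian `D²G(x) = κ D²F(x) + N DF(x) ⊗ DF(x)` of the boundary-adapted height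
function at its critical points (module docstring), so those have Morse index `≤ p - 1` when
`∂{F ≤ 0}` is `p`-convex — the index count "number of negative eigenvalues of `D²F|ker DF`" of
the route `ConvexityLadder` made robust (no nondegeneracy of `D²F|ker DF` is assumed).
Proof: if `W` is a `B`-negative subspace of dimension `≥ p`, then `K = W ∩ T` is `D`-negative of
dimension `≥ p - 1`; let `P ⊆ T` be a maximal positive subspace of the shifted form
`D'' = (D - ε ⟪·, ·⟫)|T`, `ε = η / (2p)`: its `D''`-orthogonal complement in `T` is
`D''`-nonpositive, hence of dimension `< p` by the Ky Fan lemma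
(`finrank_lt_of_forall_orthonormal_sum_pos_of_nonpos`), so `dim P ≥ dim T - (p - 1)` and
`T = K ⊕ P`; a vector `w ∈ W` off `T` may then be corrected by an element of `K` to
`w' = q + a g ∈ W` with `q ∈ P`, and
`B(w', w') ≥ κ (ε ‖q‖² - 2 M |a| ‖g‖ ‖q‖ - M a² ‖g‖²) + N a² ‖g‖⁴ ≥ 0`, contradicting
`B(w', w') < 0`. [folklore] -/
theorem sigNeg_lt_of_tangential_sum_pos (D B : LinearMap.BilinForm ℝ U)
    (hDs : ∀ u w, D u w = D w u) {g : U} (hg : g ≠ 0) {p : ℕ} (hp : 1 ≤ p)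
    {η M κ N : ℝ} (hη : 0 < η) (hκ : 0 < κ)
    (hM : ∀ u w, |D u w| ≤ M * ‖u‖ * ‖w‖)
    (hpos : ∀ v : Fin p → U, Orthonormal ℝ v → (∀ i, ⟪g, v i⟫_ℝ = 0) →
      η ≤ ∑ i, D (v i) (v i))
    (hN : κ * (M + 2 * p * M ^ 2 / η) ≤ N * ‖g‖ ^ 2)
    (hB : ∀ u w, B u w = κ * D u w + N * ⟪g, u⟫_ℝ * ⟪g, w⟫_ℝ) :
    sigNeg B.toQuadraticMap < p := by
  classical
  set Q := B.toQuadraticMap with hQ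
  by_contra hcon
  have hps : p ≤ sigNeg Q := not_lt.mp hcon
  obtain ⟨W, hW, hneg⟩ := exists_finrank_eq_sigNeg_and_negDef Q
  have hp0 : (0 : ℝ) < p := by exact_mod_cast hp
  -- the hyperplane `T = g^⊥`
  set T : Submodule ℝ U := (ℝ ∙ g)ᗮ with hT
  have hmemT : ∀ u, u ∈ T ↔ ⟪g, u⟫_ℝ = 0 := fun u =>
    Submodule.mem_orthogonal_singleton_iff_inner_right
  have hTdim : finrank ℝ T + 1 = finrank ℝ U := by
    have h1 := Submodule.finrank_add_finrank_orthogonal (ℝ ∙ g)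
    rw [finrank_span_singleton hg, ← hT] at h1
    omega
  have hgn : 0 < ‖g‖ := norm_pos_iff.mpr hg
  have hg2 : 0 < ‖g‖ ^ 2 := by positivity
  have hM0 : 0 ≤ M := by
    have h1 := hM g g
    have h2 : 0 ≤ |D g g| := abs_nonneg _
    nlinarith
  -- `Q` is negative on `W`
  have hQneg : ∀ w ∈ W, w ≠ 0 → Q w < 0 := by
    intro w hw hw0
    have hne : (⟨w, hw⟩ : W) ≠ 0 := fun h => hw0 (congrArg Subtype.val h)
    have := hneg ⟨w, hw⟩ hne
    simpa only [QuadraticMap.restrict_apply, QuadraticMap.neg_apply, neg_pos] using this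
  have hQapply : ∀ w, Q w = κ * D w w + N * ⟪g, w⟫_ℝ * ⟪g, w⟫_ℝ := fun w => by
    rw [hQ, LinearMap.BilinMap.toQuadraticMap_apply, hB]
  -- `K := W ⊓ T` is `D`-negative
  set K : Submodule ℝ U := W ⊓ T with hK
  have hKneg : ∀ k ∈ K, k ≠ 0 → D k k < 0 := by
    intro k hk hk0
    have hkT : ⟪g, k⟫_ℝ = 0 := (hmemT k).1 hk.2
    have h1 := hQneg k hk.1 hk0
    rw [hQapply, hkT] at h1
    simp only [mul_zero, add_zero] at h1
    by_contra h2
    push Not at h2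
    have : 0 ≤ κ * D k k := mul_nonneg hκ.le h2
    linarith
  have hKdim : finrank ℝ W ≤ finrank ℝ K + 1 := by
    have h1 := Submodule.finrank_sup_add_finrank_inf_eq W T
    rw [← hK] at h1
    have h2 : finrank ℝ ↥(W ⊔ T) ≤ finrank ℝ U := Submodule.finrank_le _
    omega
  -- the shifted tangential form `D'' = (D - ε ⟪·,·⟫)|T`
  set ε : ℝ := η / (2 * p) with hε
  have hε0 : 0 < ε := div_pos hη (by positivity)
  set Dε : LinearMap.BilinForm ℝ U := D - ε • innerₗ U with hDε
  have hDε_apply : ∀ u w, Dε u w = D u w - ε * ⟪u, w⟫_ℝ := fun u w => by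
    simp [hDε]
  set D'' : LinearMap.BilinForm ℝ T := Dε.restrict T with hD''
  have hD''_apply : ∀ x y : T, D'' x y = D x y - ε * ⟪(x : U), y⟫_ℝ := fun x y => by
    simp only [hD'', LinearMap.BilinForm.restrict_apply, LinearMap.domRestrict_apply]
    exact hDε_apply x y
  have hD''symm : D''.IsSymm :=
    ⟨fun x y => by rw [hD''_apply, hD''_apply, hDs, real_inner_comm]⟩
  set Q'' := D''.toQuadraticMap with hQ''
  have hQ''_apply : ∀ x : T, Q'' x = D x x - ε * ‖(x : U)‖ ^ 2 := fun x => by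
    rw [hQ'', LinearMap.BilinMap.toQuadraticMap_apply, hD''_apply, real_inner_self_eq_norm_sq]
  -- `Q''` is positive on orthonormal `p`-frames
  have hQ''pos : ∀ v : Fin p → T, Orthonormal ℝ v → 0 < ∑ i, Q'' (v i) := by
    intro v hv
    have hv' : Orthonormal ℝ (fun i => (v i : U)) := hv.comp_linearIsometry T.subtypeₗᵢ
    have htan : ∀ i, ⟪g, (v i : U)⟫_ℝ = 0 := fun i => (hmemT _).1 (v i).2
    have h1 := hpos _ hv' htan
    have hnorm : ∀ i, ‖(v i : U)‖ = 1 := fun i => hv'.1 i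
    simp only [hQ''_apply, hnorm, one_pow, mul_one, Finset.sum_sub_distrib, Finset.sum_const,
      Finset.card_univ, Fintype.card_fin, nsmul_eq_mul]
    have : (p : ℝ) * ε = η / 2 := by
      rw [hε]; field_simp
    linarith
  -- a maximal positive subspace `P` of `Q''` and its `D''`-orthogonal complement
  obtain ⟨P, hP, hPpos⟩ := exists_finrank_eq_sigPos_and_posDef Q''
  set Pc : Submodule ℝ T := D''.orthogonal P with hPc
  have hPc_nonpos : ∀ z ∈ Pc, Q'' z ≤ 0 := by
    intro z hz
    by_contra hzpos
    push Not at hzpos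
    have hzP : z ∉ P := by
      intro hzP'
      have h0 : D'' z z = 0 := (LinearMap.BilinForm.mem_orthogonal_iff.1 hz) z hzP'
      rw [hQ'', LinearMap.BilinMap.toQuadraticMap_apply] at hzpos
      linarith
    have hz0 : z ≠ 0 := fun h => hzP (h ▸ P.zero_mem)
    have hpos' : (Q''.restrict (P ⊔ (ℝ ∙ z))).PosDef := by
      intro x hx0
      obtain ⟨y, hy, w, hw, hyw⟩ := Submodule.mem_sup.1 x.2
      obtain ⟨a, rfl⟩ := Submodule.mem_span_singleton.1 hw
      rw [QuadraticMap.restrict_apply]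
      have hx : (x : T) = y + a • z := hyw.symm
      have hortho : D'' y z = 0 := (LinearMap.BilinForm.mem_orthogonal_iff.1 hz) y hy
      have hortho' : D'' z y = 0 := by rw [hD''symm.eq]; exact hortho
      have hexp : Q'' (y + a • z) = Q'' y + a ^ 2 * Q'' z := by
        simp only [hQ'', LinearMap.BilinMap.toQuadraticMap_apply, map_add, map_smul,
          LinearMap.add_apply, LinearMap.smul_apply, smul_eq_mul, hortho, hortho']
        ring
      rw [hx, hexp]
      by_cases hy0 : y = 0
      · have ha : a ≠ 0 := by
          rintro rfl
          apply hx0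
          ext1
          rw [hx, hy0, zero_smul, add_zero]
          rfl
        rw [hy0, map_zero, zero_add]
        have : 0 < a ^ 2 := by positivity
        positivity
      · have hyne : (⟨y, hy⟩ : P) ≠ 0 := fun h => hy0 (congrArg Subtype.val h)
        have h1 := hPpos ⟨y, hy⟩ hyne
        rw [QuadraticMap.restrict_apply] at h1
        have h2 : 0 ≤ a ^ 2 * Q'' z := by positivity
        change 0 < Q'' y + a ^ 2 * Q'' z
        linarith [h1]
    have hdim : finrank ℝ ↥(P ⊔ (ℝ ∙ z)) = finrank ℝ P + 1 := by
      have h1 := Submodule.finrank_sup_add_finrank_inf_eq P (ℝ ∙ z)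
      have h2 : P ⊓ (ℝ ∙ z) = ⊥ :=
        disjoint_iff.1 ((Submodule.disjoint_span_singleton' hz0).2 hzP)
      rw [h2, finrank_bot, finrank_span_singleton hz0] at h1
      omega
    have h3 := le_sigPos_of_posDef Q'' hpos'
    rw [hdim, ← hP] at h3
    omega
  have hPc_dim : finrank ℝ Pc < p :=
    finrank_lt_of_forall_orthonormal_sum_pos_of_nonpos Q'' hQ''pos Pc hPc_nonpos
  have hPdim : finrank ℝ T ≤ finrank ℝ P + finrank ℝ Pc := by
    have h1 := LinearMap.BilinForm.finrank_add_finrank_orthogonal hD''symm.isRefl P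
    rw [← hPc] at h1
    omega
  -- transport `P` to `U`
  set PU : Submodule ℝ U := P.map T.subtype with hPU
  have hPUdim : finrank ℝ PU = finrank ℝ P := Submodule.finrank_map_subtype_eq T P
  have hPU_le : PU ≤ T := Submodule.map_subtype_le T P
  have hPU_pos : ∀ q ∈ PU, ε * ‖q‖ ^ 2 ≤ D q q := by
    intro q hq
    obtain ⟨q', hq', rfl⟩ := Submodule.mem_map.1 hq
    by_cases h0 : q' = 0
    · simp [h0]
    · have hne : (⟨q', hq'⟩ : P) ≠ 0 := fun h => h0 (congrArg Subtype.val h)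
      have h1 := hPpos ⟨q', hq'⟩ hne
      rw [QuadraticMap.restrict_apply, hQ''_apply] at h1
      change ε * ‖(q' : U)‖ ^ 2 ≤ D (q' : U) (q' : U)
      linarith
  have hKPU : K ⊓ PU = ⊥ := by
    rw [eq_bot_iff]
    intro x hx
    by_contra hx0
    have h1 := hKneg x hx.1 hx0
    have h2 := hPU_pos x hx.2
    have : 0 ≤ ε * ‖x‖ ^ 2 := by positivity
    linarith
  have hKle : K ≤ T := inf_le_right
  have hsupdim : finrank ℝ ↥(K ⊔ PU) = finrank ℝ K + finrank ℝ PU := by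
    have h1 := Submodule.finrank_sup_add_finrank_inf_eq K PU
    rw [hKPU, finrank_bot] at h1
    omega
  have hsup : K ⊔ PU = T := by
    apply Submodule.eq_of_le_of_finrank_le (sup_le hKle hPU_le)
    rw [hsupdim]
    omega
  -- a vector of `W` off the hyperplane
  obtain ⟨w, hwW, hwT⟩ : ∃ w ∈ W, w ∉ T := by
    by_contra hall
    push Not at hall
    have hWK : W ≤ K := le_inf le_rfl hall
    have h1 : finrank ℝ W ≤ finrank ℝ K := Submodule.finrank_mono hWK
    have h2 : finrank ℝ ↥(K ⊔ PU) = finrank ℝ T := by rw [hsup]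
    rw [hsupdim] at h2
    omega
  have hgw : ⟪g, w⟫_ℝ ≠ 0 := fun h => hwT ((hmemT w).2 h)
  set a : ℝ := ⟪g, w⟫_ℝ / ‖g‖ ^ 2 with ha
  have ha0 : a ≠ 0 := div_ne_zero hgw hg2.ne'
  set t : U := w - a • g with ht
  have htT : t ∈ T := by
    rw [hmemT, ht, inner_sub_right, real_inner_smul_right, real_inner_self_eq_norm_sq, ha]
    field_simp
    ring
  have htKP : t ∈ K ⊔ PU := hsup.symm ▸ htT
  obtain ⟨k, hk, q, hq, hkq⟩ := Submodule.mem_sup.1 htKP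
  set w' : U := w - k with hw'
  have hw'W : w' ∈ W := W.sub_mem hwW hk.1
  have hw'eq : w' = q + a • g := by
    have h1 : w = t + a • g := by rw [ht]; abel
    rw [hw', h1, ← hkq]; abel
  have hgq : ⟪g, q⟫_ℝ = 0 := (hmemT q).1 (hPU_le hq)
  have hgw' : ⟪g, w'⟫_ℝ = a * ‖g‖ ^ 2 := by
    rw [hw'eq, inner_add_right, hgq, real_inner_smul_right, real_inner_self_eq_norm_sq]
    ring
  have hw'0 : w' ≠ 0 := by
    intro h0
    have h1 : ⟪g, w'⟫_ℝ = 0 := by rw [h0, inner_zero_right]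
    rw [hgw'] at h1
    exact (mul_ne_zero ha0 hg2.ne') h1
  have hlt := hQneg w' hw'W hw'0
  -- the lower bound contradicting `Q w' < 0`
  have hDq : ε * ‖q‖ ^ 2 ≤ D q q := hPU_pos q hq
  have hexp : D (q + a • g) (q + a • g) = D q q + a * D q g + a * D g q + a ^ 2 * D g g := by
    simp only [map_add, map_smul, LinearMap.add_apply, LinearMap.smul_apply, smul_eq_mul]
    ring
  rw [hQapply, hgw', hw'eq, hexp] at hlt
  set x : ℝ := ‖q‖ with hx
  set y : ℝ := |a| * ‖g‖ with hy
  have hx0 : 0 ≤ x := norm_nonneg _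
  have hy0 : 0 ≤ y := by positivity
  have hb1 : -(M * x * y) ≤ a * D q g := by
    have h1 : |a * D q g| ≤ |a| * (M * ‖q‖ * ‖g‖) := by
      rw [abs_mul]
      exact mul_le_mul_of_nonneg_left (hM q g) (abs_nonneg a)
    have h2 := (abs_le.1 h1).1
    have h3 : |a| * (M * ‖q‖ * ‖g‖) = M * x * y := by rw [hx, hy]; ring
    linarith
  have hb2 : -(M * x * y) ≤ a * D g q := by
    have h1 : |a * D g q| ≤ |a| * (M * ‖g‖ * ‖q‖) := by
      rw [abs_mul]
      exact mul_le_mul_of_nonneg_left (hM g q) (abs_nonneg a)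
    have h2 := (abs_le.1 h1).1
    have h3 : |a| * (M * ‖g‖ * ‖q‖) = M * x * y := by rw [hx, hy]; ring
    linarith
  have hb3 : -(M * y ^ 2) ≤ a ^ 2 * D g g := by
    have h1 := (abs_le.1 (hM g g)).1
    have h2 : a ^ 2 * (-(M * ‖g‖ * ‖g‖)) ≤ a ^ 2 * D g g :=
      mul_le_mul_of_nonneg_left h1 (sq_nonneg a)
    have h3 : a ^ 2 * (-(M * ‖g‖ * ‖g‖)) = -(M * y ^ 2) := by
      rw [hy, mul_pow, sq_abs]; ring
    linarith
  have hN' : κ * (M + M ^ 2 / ε) ≤ N * ‖g‖ ^ 2 := by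
    have : 2 * p * M ^ 2 / η = M ^ 2 / ε := by
      rw [hε]; field_simp
    rw [← this]; exact hN
  have hb4 : κ * (M + M ^ 2 / ε) * y ^ 2 ≤ N * (a * ‖g‖ ^ 2) * (a * ‖g‖ ^ 2) := by
    have h1 : N * (a * ‖g‖ ^ 2) * (a * ‖g‖ ^ 2) = N * ‖g‖ ^ 2 * y ^ 2 := by
      rw [hy, mul_pow, sq_abs]; ring
    rw [h1]
    exact mul_le_mul_of_nonneg_right hN' (sq_nonneg y)
  have hmain : 0 ≤ κ * (D q q + a * D q g + a * D g q + a ^ 2 * D g g) +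
      N * (a * ‖g‖ ^ 2) * (a * ‖g‖ ^ 2) := by
    have h1 : κ * (ε * x ^ 2 - M * x * y - M * x * y - M * y ^ 2) ≤
        κ * (D q q + a * D q g + a * D g q + a ^ 2 * D g g) :=
      mul_le_mul_of_nonneg_left (by linarith) hκ.le
    have h2 : 0 ≤ κ * (ε * x ^ 2 - M * x * y - M * x * y - M * y ^ 2) +
        κ * (M + M ^ 2 / ε) * y ^ 2 := by
      have h3 : κ * (ε * x ^ 2 - M * x * y - M * x * y - M * y ^ 2) +
          κ * (M + M ^ 2 / ε) * y ^ 2 = κ / ε * (ε * x - M * y) ^ 2 := by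
        field_simp
        ring
      rw [h3]
      positivity
    linarith
  linarith

/-- **Nondegeneracy of the Hessian of a boundary-adapted function.**  With `D`, `g ≠ 0`,
`|D(u, w)| ≤ M ‖u‖ ‖w‖` as in `sigNeg_lt_of_tangential_sum_pos`, suppose `D` is nondegenerate
on the hyperplane `T = g^⊥` with margin `m₀ > 0`: for every `t ∈ T` there is `u ∈ T`,
`‖u‖ ≤ 1`, with `m₀ ‖t‖ ≤ |D(t, u)|`.  Then for `κ > 0` and `N ‖g‖² > κ M (1 + M / m₀)` the form
`B(u, w) = κ D(u, w) + N ⟪g, u⟫ ⟪g, w⟫` is nondegenerate: if `B(w, ·) = 0`, write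
`w = t + a g` with `t ∈ T`; testing against `T` gives `D(t, ·)|T = -a D(g, ·)|T`, so
`m₀ ‖t‖ ≤ |a| M ‖g‖`, and testing against `g` gives `N a ‖g‖⁴ = -κ (D(t, g) + a D(g, g))`, whose
right-hand side is at most `κ |a| M ‖g‖² (1 + M / m₀)` in absolute value, forcing `a = 0` and
then `t = 0`.  (At the critical points of the boundary-adapted height function `D²F|ker DF` is
nondegenerate for a generic direction `a`, and `N` is as large as wanted.) [folklore] -/
theorem nondegenerate_of_tangential_margin (D B : LinearMap.BilinForm ℝ U) {g : U} (hg : g ≠ 0)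
    {m₀ M κ N : ℝ} (hm₀ : 0 < m₀) (hκ : 0 < κ)
    (hM : ∀ u w, |D u w| ≤ M * ‖u‖ * ‖w‖)
    (hmargin : ∀ t, ⟪g, t⟫_ℝ = 0 → ∃ u, ⟪g, u⟫_ℝ = 0 ∧ ‖u‖ ≤ 1 ∧ m₀ * ‖t‖ ≤ |D t u|)
    (hN : κ * M * (1 + M / m₀) < N * ‖g‖ ^ 2)
    (hB : ∀ u w, B u w = κ * D u w + N * ⟪g, u⟫_ℝ * ⟪g, w⟫_ℝ) :
    B.Nondegenerate := by
  refine LinearMap.BilinForm.Nondegenerate.ofSeparatingLeft ?_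
  intro w hw
  have hgn : 0 < ‖g‖ := norm_pos_iff.mpr hg
  have hg2 : 0 < ‖g‖ ^ 2 := by positivity
  have hM0 : 0 ≤ M := by
    have h1 := hM g g
    have h2 : 0 ≤ |D g g| := abs_nonneg _
    nlinarith
  set a : ℝ := ⟪g, w⟫_ℝ / ‖g‖ ^ 2 with ha
  set t : U := w - a • g with ht
  have hgt : ⟪g, t⟫_ℝ = 0 := by
    rw [ht, inner_sub_right, real_inner_smul_right, real_inner_self_eq_norm_sq, ha]
    field_simp
    ring
  have hwt : w = t + a • g := by rw [ht]; abel
  -- tangential equations: `D t u = -a D g u` for `u ∈ T`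
  have htan : ∀ u, ⟪g, u⟫_ℝ = 0 → D t u = -(a * D g u) := by
    intro u hu
    have h1 := hw u
    rw [hB, hu, mul_zero, add_zero] at h1
    have h2 : D w u = 0 := by
      rcases mul_eq_zero.1 h1 with h | h
      · exact absurd h hκ.ne'
      · exact h
    have h3 : D w u = D t u + a * D g u := by
      rw [hwt]
      simp only [map_add, map_smul, LinearMap.add_apply, LinearMap.smul_apply, smul_eq_mul]
    linarith
  -- the margin bounds `‖t‖`
  obtain ⟨u, hu, hu1, hmar⟩ := hmargin t hgt
  have htnorm : m₀ * ‖t‖ ≤ |a| * M * ‖g‖ := by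
    have h1 : |D t u| ≤ |a| * M * ‖g‖ := by
      rw [htan u hu, abs_neg, abs_mul]
      calc |a| * |D g u| ≤ |a| * (M * ‖g‖ * ‖u‖) :=
            mul_le_mul_of_nonneg_left (hM g u) (abs_nonneg a)
        _ ≤ |a| * (M * ‖g‖ * 1) := by gcongr
        _ = |a| * M * ‖g‖ := by ring
    exact hmar.trans h1
  -- the normal equation
  have hnorm : N * (a * ‖g‖ ^ 2) * ‖g‖ ^ 2 = -(κ * (D t g + a * D g g)) := by
    have h1 := hw g
    rw [hB, real_inner_self_eq_norm_sq] at h1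
    have h2 : ⟪g, w⟫_ℝ = a * ‖g‖ ^ 2 := by
      rw [ha]; field_simp
    have h3 : D w g = D t g + a * D g g := by
      rw [hwt]
      simp only [map_add, map_smul, LinearMap.add_apply, LinearMap.smul_apply, smul_eq_mul]
    rw [h2, h3] at h1
    linarith
  -- conclude `a = 0`
  have ha0 : a = 0 := by
    by_contra ha0
    have hapos : 0 < |a| := abs_pos.mpr ha0
    have h1 : |N * (a * ‖g‖ ^ 2) * ‖g‖ ^ 2| ≤ κ * (|a| * M * ‖g‖ ^ 2 * (1 + M / m₀)) := by
      rw [hnorm, abs_neg, abs_mul, abs_of_pos hκ]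
      refine mul_le_mul_of_nonneg_left ?_ hκ.le
      have h2 : |D t g| ≤ M * ‖t‖ * ‖g‖ := hM t g
      have h3 : |a * D g g| ≤ |a| * (M * ‖g‖ * ‖g‖) := by
        rw [abs_mul]; exact mul_le_mul_of_nonneg_left (hM g g) (abs_nonneg a)
      have h4 : ‖t‖ ≤ |a| * M * ‖g‖ / m₀ := by
        rw [le_div_iff₀ hm₀]; linarith
      have h5 : M * ‖t‖ * ‖g‖ ≤ M * (|a| * M * ‖g‖ / m₀) * ‖g‖ := by gcongr
      calc |D t g + a * D g g| ≤ |D t g| + |a * D g g| := abs_add_le _ _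
        _ ≤ M * (|a| * M * ‖g‖ / m₀) * ‖g‖ + |a| * (M * ‖g‖ * ‖g‖) := by linarith
        _ = |a| * M * ‖g‖ ^ 2 * (1 + M / m₀) := by
          field_simp
          ring
    have h2 : |N * (a * ‖g‖ ^ 2) * ‖g‖ ^ 2| = N * ‖g‖ ^ 2 * (|a| * ‖g‖ ^ 2) := by
      have hNpos : 0 < N * ‖g‖ ^ 2 := by
        have : 0 ≤ κ * M * (1 + M / m₀) := by positivity
        linarith
      have hN0 : 0 < N := by
        by_contra h; push Not at h
        have : N * ‖g‖ ^ 2 ≤ 0 := mul_nonpos_of_nonpos_of_nonneg h hg2.le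
        linarith
      rw [abs_mul, abs_mul, abs_mul, abs_of_pos hN0, abs_of_pos hg2]
      ring
    rw [h2] at h1
    have h3 : N * ‖g‖ ^ 2 * (|a| * ‖g‖ ^ 2) ≤ κ * M * (1 + M / m₀) * (|a| * ‖g‖ ^ 2) := by
      calc N * ‖g‖ ^ 2 * (|a| * ‖g‖ ^ 2) ≤ κ * (|a| * M * ‖g‖ ^ 2 * (1 + M / m₀)) := h1
        _ = κ * M * (1 + M / m₀) * (|a| * ‖g‖ ^ 2) := by ring
    have h4 : 0 < |a| * ‖g‖ ^ 2 := by positivity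
    have h5 := le_of_mul_le_mul_right h3 h4
    linarith
  -- hence `t = 0` and `w = 0`
  have ht0 : t = 0 := by
    have h1 : m₀ * ‖t‖ ≤ 0 := by
      have := htnorm
      rw [ha0, abs_zero, zero_mul, zero_mul] at this
      exact this
    have h2 : ‖t‖ ≤ 0 := by
      by_contra h; push Not at h
      have : 0 < m₀ * ‖t‖ := mul_pos hm₀ h
      linarith
    exact norm_le_zero_iff.1 h2
  rw [hwt, ht0, ha0, zero_smul, add_zero]

end IndexBound

end Literature.Geometry.Riemannian
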